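import Summits.BirchSwinnertonDyer.BirchSwinnertonDyer.Theorems.ResidualThetaTransportAtTwoRlfIsoOfLayerIso
import Summits.BirchSwinnertonDyer.BirchSwinnertonDyer.Theorems.ResidualThetaTransportAtTwoRlfLayerWitnessClass
import Summits.BirchSwinnertonDyer.BirchSwinnertonDyer.Theorems.ResidualThetaTransportAtTwoRlfTwistedNormSurj
import HarnessLib

/-!
# Route `ResidualThetaTransportAtTwo` (RTT P6, item stmt-BirchSwinnertonDyer-23110, road T), H-PLUSDUAL / ISO brick (C) ASSEMBLED:
# COR-SURJ `L_u = cor_{U_J}(H_J)` at `2`, and `hiso ⟸ LAYER-ISO` alone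

Width seat `bsd-wall-tp2-p2x-w2` g16 (cell `bsd-wall`), for the LEAD `bsd-wall-tp2-p2x` g12 (skeleton `hplusdual`, stub `stub_iso`).
HONEST FRAMING: THEOREMS ONLY (no definition, no named fact, no instance, no `sorry`); closes no item; `hiso` is proved here ONLY
RELATIVE to the displayed hypothesis LAYER-ISO (B. D. Kim's Prop. 3.15 read at `2` for the UNTWISTED layer-`J` classes with
`A`-witness, K3 Shapiro currency); 23110 is NOT proved; BSD is NOT proved by any of this.

B. D. Kim (Compositio 143 (2007), proof of Prop. 4.11, p. 63): «Thus we can show `Cor_𝔭(H^n_{𝔭,P}[𝔪^k]) = H^0_{𝔭,P}[𝔪^k]`». Here,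
for `W/ℚ` globally minimal, `GoodSS W 2`, `a₂ = 0`, `κ` cyclotomic, `v ∋ 2`, `u` odd, `A = ⋃ₙ E⁺(ℚ_{v,n})`:

* §1 representatives of `Γ_v ⧸ U_J` by powers `g^i`, `i < 2^J`, of a local lift `g` of the topological generator
  (`exists_powIndex`: `y ↦ i_y` with `g^{i_y} ∈ y`, `κ(g^{i_y}) mod 2^J = i_y`, and the reindexing
  `Σ_{y ∈ Γ_v/U_J} F(i_y) = Σ_{i<2^J} F(i)`);
* §2 **`exists_cores_layerWitness_eq` = COR-SURJ(`u`)**: every `x ∈ L_u(J, v)` is `cor_{U_J}^{Γ_v}[ψ]` for a `U_J`-cocycle `ψ` of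
  `M_u|` with an `A`-witness — the point `a = 2^J Q_x` of `x` is a twisted eigen-point (`exists_eigen_of_witness`), hence the twisted
  norm `Σ_{i<2^J} uⁱ gⁱ b` of a layer-`J` point class `b` (`PlusDualTwo.exists_twistedNorm_congr_two`, (R1)@2), `b` is the witness
  point of a `U_J`-cocycle (`exists_layerCocycle_of_layerFixed`, twisted by `exists_twist_layerCocycle`), whose corestriction
  (representatives `g^{i_y}`) has witness point `Σ_y u^{i_y} g^{i_y} Q ≡ Q_x` (`pointsMap_transferCocycle_apply_of_layerWitness`),
  so it IS `x` (`oneCocycleClass_eq_of_witness_sub_mem`);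
* §3 **`iso_of_layerIso`**: `hiso(u)` VERBATIM ⟸ LAYER-ISO (`iso_of_corSurj_of_layerIso` ∘ §2).

References: B. D. Kim, Compositio Math. 143 (2007), Props. 3.15, 3.17, 4.11 [BDKim2007]; S. Kobayashi, Invent. math. 152 (2003),
Def. 1.1, (8.23) [Kobayashi2003]; R. Greenberg, LNM 1716 §4 p. 124 [GreenbergLNM1716]; L. Washington, *Cyclotomic Fields* §13.1
[Washington1997].
-/

-- the Theorems namespace of this sub repeats the summit name by design (D-0017 nested layout)
set_option linter.dupNamespace false

noncomputable section

open scoped Classical NumberField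
open CategoryTheory Function Field NumberField IsDedekindDomain

namespace Summit.BirchSwinnertonDyer.BirchSwinnertonDyer.Theorems.SignedEC.TwistedLocalKummer

open Literature.NumberTheory.EllipticCurves Literature.NumberTheory.GaloisRepresentations WeierstrassCurve ZpExtension
  Literature.NumberTheory.EllipticCurves.Kobayashi2003 Literature.NumberTheory.GaloisCohomology SignedKatoOffTwo
open Literature.NumberTheory.GaloisRepresentations.DiscreteGaloisModule (localTatePairingZMod)
open scoped ContRepresentation

universe u

/-! ## §1 Representatives of `Γ_v ⧸ U_J` by powers of a local topological generator -/

section Reps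

variable (κ : ZpExtension ℚ 2) (J : ℕ) (v : HeightOneSpectrum (𝓞 ℚ)) {g : absoluteGaloisGroup (v.adicCompletion ℚ)}
  (hg : κ.IsTopGenerator (resGalOfEmb (closureEmb (K := ℚ) (v.adicCompletion ℚ)) g))

include hg in
/-- `κ(g^k) mod 2^J = k mod 2^J` for a local lift `g` of the topological generator. [cite: Washington1997, §13.1] -/
theorem twistExponent_pow_of_isTopGenerator (k : ℕ) :
    κ.twistExponent J (resGal (K := ℚ) (v.adicCompletion ℚ) (g ^ k)) = k % 2 ^ J := by
  haveI : Fact (Nat.Prime 2) := ⟨Nat.prime_two⟩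
  have hg' : κ.IsTopGenerator (resGal (K := ℚ) (v.adicCompletion ℚ) g) := by rw [resGal_eq]; exact hg
  induction k with
  | zero => rw [pow_zero, map_one, ZpExtension.twistExponent_one, Nat.zero_mod]
  | succ k ih =>
    rw [pow_succ, map_mul, ZpExtension.twistExponent_mul, ih]
    rcases Nat.eq_zero_or_pos J with hJ | hJ
    · subst hJ; simp [Nat.mod_one]
    · rw [κ.twistExponent_eq_one_of_isTopGenerator hJ hg', Nat.mod_add_mod]

/-- Elements of `Γ_v` in the same coset of `U_J` have the same exponent `κ(·) mod 2^J`. [cite: Washington1997, §13.1] -/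
theorem twistExponent_eq_of_inv_mul_mem {a b : absoluteGaloisGroup (v.adicCompletion ℚ)}
    (hab : a⁻¹ * b ∈ LayerPairing.layerGroup κ v J) :
    κ.twistExponent J (resGal (K := ℚ) (v.adicCompletion ℚ) a) = κ.twistExponent J (resGal (K := ℚ) (v.adicCompletion ℚ) b) := by
  haveI : Fact (Nat.Prime 2) := ⟨Nat.prime_two⟩
  have hab' : resGal (K := ℚ) (v.adicCompletion ℚ) (a⁻¹ * b) ∈ κ.layerSubgroup J := (mem_localSubgroupOfEmb_iff _ _ _).mp hab
  have h0 := κ.twistExponent_eq_zero_of_mem_layerSubgroup hab'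
  conv_rhs => rw [show b = a * (a⁻¹ * b) by group, map_mul, ZpExtension.twistExponent_mul, h0, add_zero,
    Nat.mod_eq_of_lt (κ.twistExponent_lt J _)]

/-- Conversely, equal exponents `κ(·) mod 2^J` mean the same coset of `U_J = κ⁻¹(2^J ℤ₂) ∩ Γ_v`. [cite: Washington1997, §13.1] -/
theorem inv_mul_mem_of_twistExponent_eq {a b : absoluteGaloisGroup (v.adicCompletion ℚ)}
    (hab : κ.twistExponent J (resGal (K := ℚ) (v.adicCompletion ℚ) a) = κ.twistExponent J (resGal (K := ℚ) (v.adicCompletion ℚ) b)) :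
    a⁻¹ * b ∈ LayerPairing.layerGroup κ v J := by
  haveI : Fact (Nat.Prime 2) := ⟨Nat.prime_two⟩
  refine (mem_localSubgroupOfEmb_iff _ _ _).mpr ?_
  rw [← resGal_eq, ZpExtension.mem_layerSubgroup, ← Ideal.mem_span_singleton, ← PadicInt.ker_toZModPow, RingHom.mem_ker, map_mul,
    map_inv, map_mul, map_inv, toAdd_mul, toAdd_inv, map_add, map_neg, neg_add_eq_zero]
  have h := congrArg (fun n : ℕ ↦ (n : ZMod (2 ^ J))) hab
  simpa only [ZpExtension.twistExponent, ZMod.natCast_zmod_val] using h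

include hg in
/-- **Representatives by powers of `g`.** Every coset `y ∈ Γ_v ⧸ U_J` contains `g^{i_y}` for a unique `i_y < 2^J`, namely
`i_y = κ(y) mod 2^J`; and `i ↦ g^i U_J` is a bijection `[0, 2^J) → Γ_v ⧸ U_J`, so that sums over `Γ_v ⧸ U_J` of functions of `i_y`
are sums over `i < 2^J`. [cite: Washington1997, §13.1] -/
theorem exists_powIndex [Fintype (absoluteGaloisGroup (v.adicCompletion ℚ) ⧸ LayerPairing.layerGroup κ v J)] :
    ∃ idx : absoluteGaloisGroup (v.adicCompletion ℚ) ⧸ LayerPairing.layerGroup κ v J → ℕ,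
      (∀ y, ((g ^ idx y : absoluteGaloisGroup (v.adicCompletion ℚ)) : absoluteGaloisGroup (v.adicCompletion ℚ) ⧸
        LayerPairing.layerGroup κ v J) = y) ∧
      (∀ y, κ.twistExponent J (resGal (K := ℚ) (v.adicCompletion ℚ) (g ^ idx y)) = idx y) ∧
      ∀ {M : Type u} [AddCommMonoid M] (F : ℕ → M), ∑ y, F (idx y) = ∑ i ∈ Finset.range (2 ^ J), F i := by
  haveI : Fact (Nat.Prime 2) := ⟨Nat.prime_two⟩
  let idx : absoluteGaloisGroup (v.adicCompletion ℚ) ⧸ LayerPairing.layerGroup κ v J → ℕ := fun y ↦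
    κ.twistExponent J (resGal (K := ℚ) (v.adicCompletion ℚ) (Quotient.out y))
  have hlt : ∀ y, idx y < 2 ^ J := fun y ↦ κ.twistExponent_lt J _
  have hpow : ∀ y, κ.twistExponent J (resGal (K := ℚ) (v.adicCompletion ℚ) (g ^ idx y)) = idx y := fun y ↦ by
    rw [twistExponent_pow_of_isTopGenerator κ J v hg, Nat.mod_eq_of_lt (hlt y)]
  have hrep : ∀ y, ((g ^ idx y : absoluteGaloisGroup (v.adicCompletion ℚ)) : absoluteGaloisGroup (v.adicCompletion ℚ) ⧸
      LayerPairing.layerGroup κ v J) = y := fun y ↦ by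
    conv_rhs => rw [← QuotientGroup.out_eq' y]
    rw [eq_comm, QuotientGroup.eq]
    exact inv_mul_mem_of_twistExponent_eq κ J v (by rw [hpow])
  refine ⟨idx, hrep, hpow, fun F ↦ ?_⟩
  refine Finset.sum_bij (fun y _ ↦ idx y) (fun y _ ↦ Finset.mem_range.mpr (hlt y)) (fun y₁ _ y₂ _ h ↦ ?_) (fun i hi ↦ ?_)
    (fun _ _ ↦ rfl)
  · rw [← hrep y₁, ← hrep y₂, h]
  · refine ⟨((g ^ i : absoluteGaloisGroup (v.adicCompletion ℚ)) : absoluteGaloisGroup (v.adicCompletion ℚ) ⧸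
      LayerPairing.layerGroup κ v J), Finset.mem_univ _, ?_⟩
    have h1 : κ.twistExponent J (resGal (K := ℚ) (v.adicCompletion ℚ) (Quotient.out ((g ^ i : absoluteGaloisGroup (v.adicCompletion ℚ)) :
        absoluteGaloisGroup (v.adicCompletion ℚ) ⧸ LayerPairing.layerGroup κ v J))) =
        κ.twistExponent J (resGal (K := ℚ) (v.adicCompletion ℚ) (g ^ i)) :=
      twistExponent_eq_of_inv_mul_mem κ J v (QuotientGroup.eq.mp (QuotientGroup.out_eq' _))
    change κ.twistExponent J (resGal (K := ℚ) (v.adicCompletion ℚ) (Quotient.out _)) = i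
    rw [h1, twistExponent_pow_of_isTopGenerator κ J v hg, Nat.mod_eq_of_lt (Finset.mem_range.mp hi)]

end Reps

/-! ## §2 COR-SURJ: `L_u = cor_{U_J}(H_J)` -/

/-- **COR-SURJ at `2` (B. D. Kim's `Cor_𝔭(H^n_{𝔭,P}[𝔪^k]) = H^0_{𝔭,P}[𝔪^k]`, signed, twisted, layer `J`).** For `E/ℚ` globally minimal,
`GoodSS E 2`, `a₂(E) = 0`, `κ` cyclotomic, `u` odd, `v ∋ 2` and every `J`: every class `x` of the twisted signed local Kummer condition
`L_u = twistedTorsionLocalKummer 2 κ J u hu ℚ_v (⋃ₙ E⁺(ℚ_{v,n}))` is the corestriction `cor_{U_J}^{Γ_v}[ψ]` of a continuous `U_J`-cocycle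
`ψ` of `E[2^J](χ_u)|` with an `A`-witness `(Q, k)` on `N = Gal(ℚ̄_v/ℚ_{v,∞})` — EXACTLY the hypothesis `hCor` of
`iso_of_corSurj_of_layerIso`. [cite: BDKim2007, Prop. 4.11 (proof, p. 63)] [cite: BDKim2007, Prop. 3.15 (proof)] -/
theorem exists_cores_layerWitness_eq (E : WeierstrassCurve ℚ) [E.IsElliptic] [E.IsGloballyMinimal]
    (hss : Rank1Residual.GoodSS E 2) (ha : E.frobeniusTrace 2 = 0) {κ : ZpExtension ℚ 2} (hκ : κ.IsCyclotomic)
    (u : ℤ) (hu : (2 : ℤ) ∣ u - 1) (J : ℕ) (v : HeightOneSpectrum (𝓞 ℚ))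
    [Fintype (absoluteGaloisGroup (v.adicCompletion ℚ) ⧸ LayerPairing.layerGroup κ v J)] (hv : ((2 : ℕ) : 𝓞 ℚ) ∈ v.asIdeal)
    (x : galoisCohomology ((E.twistedTorsionGaloisModule 2 κ J u hu).restrictField (v.adicCompletion ℚ)) 1)
    (hx : x ∈ E.twistedTorsionLocalKummer 2 κ J u hu (v.adicCompletion ℚ) (⨆ n : ℕ, signedLocalPoints κ (v.adicCompletion ℚ) E 1 n)) :
    ∃ (ψ : contOneCocycles (subgroupRep ((E.twistedTorsionGaloisModule 2 κ J u hu).restrictField (v.adicCompletion ℚ)).toTopRep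
        (LayerPairing.layerGroup κ v J))) (Q : localPoints E (v.adicCompletion ℚ)) (k : ℕ),
      cores ((E.twistedTorsionGaloisModule 2 κ J u hu).restrictField (v.adicCompletion ℚ)).toTopRep (LayerPairing.layerGroup κ v J)
          (LayerPairing.isOpen_layerGroup κ v J) (oneCocycleClass _ ψ) = x ∧
      2 ^ k • Q ∈ (⨆ n : ℕ, signedLocalPoints κ (v.adicCompletion ℚ) E 1 n) ∧
      ∀ (τ : absoluteGaloisGroup (v.adicCompletion ℚ)) (hτ : τ ∈ localSubgroup κ.kerSubgroup (v.adicCompletion ℚ)),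
        pointsMap E (v.adicCompletion ℚ) ((ψ.1 ⟨τ, kerLocal_le_layerGroup κ v J hτ⟩ : E.geomTorsion ((2 ^ J : ℕ) : ℤ)) :
          E.geomPoints) = τ • Q - Q := by
  haveI : Fact (Nat.Prime 2) := ⟨Nat.prime_two⟩
  have hv' : (2 : 𝓞 ℚ) ∈ v.asIdeal := by exact_mod_cast hv
  set A : AddSubgroup (localPoints E (v.adicCompletion ℚ)) := ⨆ n : ℕ, signedLocalPoints κ (v.adicCompletion ℚ) E 1 n with hAdef
  have galois_smul_nsmul : ∀ (τ : absoluteGaloisGroup (v.adicCompletion ℚ)) (c : ℕ) (P : localPoints E (v.adicCompletion ℚ)),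
      τ • (c • P) = c • (τ • P) := fun τ c P ↦ map_nsmul (DistribSMul.toAddMonoidHom _ τ) c P
  obtain ⟨g, hg⟩ := ZpExtension.IsCyclotomic.exists_isTopGenerator_resGalOfEmb_adicCompletion hκ v hv'
  obtain ⟨u', hu', huu'⟩ := TwistedPT.exists_inverse_twist (p := 2) hu J
  -- the witness of `x` and its twisted eigen-point `a = 2^J Q_x`
  obtain ⟨ψx, Qx, kx, hψx, hkQx, hwitx⟩ := (mem_twistedTorsionLocalKummer_iff _ _).mp hx
  have haA : 2 ^ J • Qx ∈ A := nsmul_mem_of_witness E hss κ J u hu v hv' ψx Qx hkQx hwitx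
  have heig := exists_eigen_of_witness E hss κ J hu huu' v hv' hg ψx Qx hkQx hwitx
  -- point-level COR-SURJ: `a ≡ Σ_{i<2^J} uⁱ gⁱ b` with `g^{2^J} b ≡ b`
  obtain ⟨b, hbA, hbfix, wN, hwNA, hwN⟩ := PlusDualTwo.exists_twistedNorm_congr_two E hss ha hκ v hv' hg J hu huu' haA heig
  -- the layer-`J` witness class of `b`, twisted
  obtain ⟨ψ₀, Q, hQb, hwit₀⟩ := exists_layerCocycle_of_layerFixed E κ J v hg hbA hbfix
  obtain ⟨ψ, hψ⟩ := exists_twist_layerCocycle E κ J u hu v ψ₀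
  have hwit : ∀ (τ : absoluteGaloisGroup (v.adicCompletion ℚ)) (hτ : τ ∈ localSubgroup κ.kerSubgroup (v.adicCompletion ℚ)),
      pointsMap E (v.adicCompletion ℚ) ((ψ.1 ⟨τ, kerLocal_le_layerGroup κ v J hτ⟩ : E.geomTorsion ((2 ^ J : ℕ) : ℤ)) : E.geomPoints) =
        τ • Q - Q := fun τ hτ ↦ by rw [hψ]; exact hwit₀ τ hτ
  have hkQ : 2 ^ J • Q ∈ A := by rw [hQb]; exact hbA
  refine ⟨ψ, Q, J, ?_, hkQ, hwit⟩
  -- corestriction with the representatives `g^{i_y}`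
  obtain ⟨idx, hrep, hidx, hsum⟩ := exists_powIndex κ J v hg
  rw [cores_oneCocycleClass _ _ _ (s := fun y ↦ g ^ idx y) hrep, ← hψx]
  refine oneCocycleClass_eq_of_witness_sub_mem E hss κ J u hu v hv' _ ψx
    (∑ y, (u ^ κ.twistExponent J (resGal (K := ℚ) (v.adicCompletion ℚ) (g ^ idx y))) • (g ^ idx y • Q)) Qx
    (fun τ ↦ pointsMap_transferCocycle_apply_of_layerWitness E κ J u hu v (s := fun y ↦ g ^ idx y) hrep ψ Q hwit τ τ.2) hwitx ?_
  -- `2^J Q' = Σ_{i<2^J} uⁱ gⁱ b ≡ a (mod 2^J A)`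
  refine ⟨wN, hwNA, ?_⟩
  rw [← hwN, Finset.smul_sum]
  congr 1
  rw [← hsum (fun i ↦ u ^ i • (g ^ i • b))]
  refine Finset.sum_congr rfl fun y _ ↦ ?_
  rw [hidx, smul_comm (2 ^ J) (u ^ idx y), ← galois_smul_nsmul, hQb]

/-! ## §3 `hiso(u)` from LAYER-ISO alone -/

/-- **ISO modulo LAYER-ISO.** For `E/ℚ` globally minimal with `GoodSS E 2`, `a₂(E) = 0`, `κ` cyclotomic and `u` odd: LAYER-ISO (the
UNTWISTED layer-`J` classes with `A`-witness are isotropic for the K3 layer pairing `layerSumPairing … J` — B. D. Kim Prop. 3.15 at `2`)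
implies `hiso(u)` VERBATIM (the binder of `plusDualAlt_of_iso`, the inner clause of `stub_iso`). (`iso_of_corSurj_of_layerIso` with
COR-SURJ = `exists_cores_layerWitness_eq`.) [cite: BDKim2007, Props. 3.15, 4.11] [cite: MilneADT2006, Ch. I Cor. 2.3] -/
theorem iso_of_layerIso (E : WeierstrassCurve ℚ) [E.IsElliptic] [E.IsGloballyMinimal]
    (hss : Rank1Residual.GoodSS E 2) (ha : E.frobeniusTrace 2 = 0) {κ : ZpExtension ℚ 2} (hκ : κ.IsCyclotomic)
    (u : ℤ) (hu : (2 : ℤ) ∣ u - 1)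
    (hLI : ∀ (J : ℕ) (e : E.geomTorsion ((2 ^ J : ℕ) : ℤ) → E.geomTorsion ((2 ^ J : ℕ) : ℤ) → AlgebraicClosure ℚ)
      (hμ : ∀ S T, e S T ^ (2 ^ J) = 1) (hadd₁ : ∀ S₁ S₂ T, e (S₁ + S₂) T = e S₁ T * e S₂ T)
      (hadd₂ : ∀ S T₁ T₂, e S (T₁ + T₂) = e S T₁ * e S T₂)
      (hgal : ∀ (σ : absoluteGaloisGroup ℚ) (S T : E.geomTorsion ((2 ^ J : ℕ) : ℤ)), σ • e S T = e (σ • S) (σ • T)),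
      (∀ T, e T T = 1) → (∀ T, (∀ S, e S T = 1) → T = 0) → ∀ [NeZero (2 ^ J)],
      ∀ (v : HeightOneSpectrum (𝓞 ℚ)) [CompactSpace (absoluteGaloisGroup (v.adicCompletion ℚ))], ((2 : ℕ) : 𝓞 ℚ) ∈ v.asIdeal →
      ∀ (f₀ g₀ : contOneCocycles (subgroupRep (LayerPairing.torsionLocalRep E (2 ^ J) v) (LayerPairing.layerGroup κ v J)))
        (Qf Qg : localPoints E (v.adicCompletion ℚ)) (kf kg : ℕ),
        2 ^ kf • Qf ∈ (⨆ n : ℕ, signedLocalPoints κ (v.adicCompletion ℚ) E 1 n) →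
        (∀ (τ : absoluteGaloisGroup (v.adicCompletion ℚ)) (hτ : τ ∈ localSubgroup κ.kerSubgroup (v.adicCompletion ℚ)),
          pointsMap E (v.adicCompletion ℚ) ((f₀.1 ⟨τ, kerLocal_le_layerGroup κ v J hτ⟩ : E.geomTorsion ((2 ^ J : ℕ) : ℤ)) :
            E.geomPoints) = τ • Qf - Qf) →
        2 ^ kg • Qg ∈ (⨆ n : ℕ, signedLocalPoints κ (v.adicCompletion ℚ) E 1 n) →
        (∀ (τ : absoluteGaloisGroup (v.adicCompletion ℚ)) (hτ : τ ∈ localSubgroup κ.kerSubgroup (v.adicCompletion ℚ)),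
          pointsMap E (v.adicCompletion ℚ) ((g₀.1 ⟨τ, kerLocal_le_layerGroup κ v J hτ⟩ : E.geomTorsion ((2 ^ J : ℕ) : ℤ)) :
            E.geomPoints) = τ • Qg - Qg) →
        (LayerPairing.layerSumPairing E (2 ^ J) e hμ hadd₁ hadd₂ hgal κ v J).cupProduct
          (LayerPairing.layerShapiro E (2 ^ J) κ v J (oneCocycleClass _ f₀))
          (LayerPairing.layerShapiro E (2 ^ J) κ v J (oneCocycleClass _ g₀)) = 0) :
    ∀ (J : ℕ) (u' : ℤ) (hu' : (2 : ℤ) ∣ u' - 1) (huu' : ((2 : ℤ) ^ J) ∣ u * u' - 1)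
      (e : E.geomTorsion ((2 ^ J : ℕ) : ℤ) → E.geomTorsion ((2 ^ J : ℕ) : ℤ) → AlgebraicClosure ℚ)
      (hμ : ∀ S T, e S T ^ (2 ^ J) = 1) (hadd₁ : ∀ S₁ S₂ T, e (S₁ + S₂) T = e S₁ T * e S₂ T)
      (hadd₂ : ∀ S T₁ T₂, e S (T₁ + T₂) = e S T₁ * e S T₂)
      (hgal : ∀ (σ : absoluteGaloisGroup ℚ) (S T : E.geomTorsion ((2 ^ J : ℕ) : ℤ)), σ • e S T = e (σ • S) (σ • T))
      (_halt : ∀ T, e T T = 1) (_hnondeg : ∀ T, (∀ S, e S T = 1) → T = 0)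
      [Finite (E.geomTorsion ((2 ^ J : ℕ) : ℤ))]
      (inv : LocalInvariants ℚ (2 ^ J)), inv.IsPerfect →
      ∀ (v : HeightOneSpectrum (𝓞 ℚ)), ((2 : ℕ) : 𝓞 ℚ) ∈ v.asIdeal →
      ∀ x ∈ E.twistedTorsionLocalKummer 2 κ J u hu (v.adicCompletion ℚ) (⨆ n : ℕ, signedLocalPoints κ (v.adicCompletion ℚ) E 1 n),
      ∀ y' ∈ E.twistedTorsionLocalKummer 2 κ J u' hu' (v.adicCompletion ℚ) (⨆ n : ℕ, signedLocalPoints κ (v.adicCompletion ℚ) E 1 n),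
        localTatePairingZMod (E.twistedTorsionGaloisModule 2 κ J u hu) (2 ^ J) (Sum.inr v) (inv (Sum.inr v)) x
          (galoisCohomology.map ((E.twistedWeilDual 2 κ J hu hu' huu' e hμ hadd₁ hadd₂ hgal).restrictField (v.adicCompletion ℚ)) 1
            y') = 0 :=
  iso_of_corSurj_of_layerIso E κ u hu (fun J v _ hv x hx ↦ exists_cores_layerWitness_eq E hss ha hκ u hu J v hv x hx) hLI

end Summit.BirchSwinnertonDyer.BirchSwinnertonDyer.Theorems.SignedEC.TwistedLocalKummer

end
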